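import Literature.MathematicalPhysics.QuantumLattice.HubbardHalfFilledSectorOrdering
import Literature.MathematicalPhysics.QuantumLattice.HubbardSpinReflectionSignRule
import HarnessLib

/-!
# Lieb's ferrimagnetism and the Shen–Qiu–Tian ferrimagnetic long-range order of the half-filled
# Hubbard model on an unbalanced bipartite graph

Topic `MathematicalPhysics/QuantumLattice` (family `hubbard`). Cell `pub/hubbard-cq`, seat
`hubbard-pc-lit-1` (positive-order certificates: a symmetry quantum number, certified by Lieb's
spin-reflection positivity, turned into a FLOOR on an order parameter). HONEST FRAMING: a
finite-volume KERNEL at half filling, `t' = 0` (bipartite hopping), any `U > 0`; nothing is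
claimed away from half filling or for non-bipartite hopping.

Setting: the Hubbard Hamiltonian `H = hamiltonian G t U` (`HubbardWave0`) on a finite connected
graph `G` on an ordered site set `Λ`, bipartite with colour class `A` (`x ∼ y → (x ∈ A ↔ y ∉ A)`,
`B = Aᶜ`), `t ≠ 0`, `U > 0`, `|Λ|` even, half filling `N = |Λ|`; NO balance hypothesis
`|A| = |B|`. Lieb's spin `S₀ = liebSpin A = ||A| - |B||/2`.

* **Spin-reflection positivity in every `(N↑, N↓)` sector** (`LiebTwo.liebGram_posSemidef_sector`,
  `liebForm_expect_nonneg_sector`): for the (unique, `LiebTwo.halfFilled_upDownSector_groundState`)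
  lowest state `ψ` of `H` in a coordinate sector `(N↑, N↓) = (p, q)`, `p + q = |Λ|`, and every finite
  family of words `w`, the Gram matrix `[⟨ψ, u(w a) d̃_ε(w b) ψ⟩]_{ab}` is positive semidefinite
  (`ε = ±` the sublattice sign). The tree's `liebGram_posSemidef` is the case `|A| = |B|`,
  `p = q`; here every `|A|, |B|` and every sector — in particular the members `S^z = m`,
  `|m| ≤ S₀`, of Lieb's ground multiplet and, on balanced graphs, the lowest TRIPLET (`p = q + 2`).
* **The transverse sign rule in every sector** (`LiebTwo.sector_sign_rule`):
  `ε_x ε_y ⟨ψ, S⁺_x S⁻_y ψ⟩ ≥ 0` for the same `ψ` (Shen–Qiu–Tian's sign rule; the tree's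
  `shenQiuTian_sign_rule` is the balanced `S^z = 0` case).
* **Lieb's ferrimagnetism** (`re_expect_sum_sum_fermionSpinDot_eq_of_isGroundState`,
  `liebSpin_sq_le_re_expect_sum_sum_fermionSpinDot`): every half-filled ground state `ψ` has
  `⟨ψ, (Σ_{x,y} 𝐒_x·𝐒_y) ψ⟩ = S₀(S₀+1)‖ψ‖² ≥ ¼(|A| - |B|)²‖ψ‖²` — the uniform (ferromagnetic) spin
  structure factor has the floor `S₀(S₀+1)`, extensive squared when `|A| - |B| ∝ |Λ|` (Lieb 1989,
  Theorem 2 and the remark after it; Tasaki 1998 §5.3 "Lieb's ferrimagnetism"; Miyao, Prop. 3.9).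
* **Shen–Qiu–Tian: the staggered structure factor dominates the uniform one**
  (`liebSpin_le_re_expect_stagSpinStructure`, `sq_card_sub_le_re_expect_stagSpinStructure`): for
  the half-filled ground state `ψ₀` with `S^z ψ₀ = 0` (it exists and is unique up to a scalar,
  `exists_szZero_groundState`),
  `Re ⟨ψ₀, 𝓢_A ψ₀⟩ ≥ S₀(S₀+1)‖ψ₀‖² ≥ ¼(|A| - |B|)²‖ψ₀‖²`, `𝓢_A = Σ_{x,y} ε_x ε_y 𝐒_x·𝐒_y`
  (`FermionSpinMoment.stagSpinStructure`): ferromagnetic AND antiferromagnetic long-range order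
  coexist when `|A| - |B| ∝ |Λ|` (ferrimagnetism).

## The mechanism (a Lean proof; the printed proofs are not reproduced)

`𝓢_A = S² - 4 Σ_{x∈A, y∈B} 𝐒_x·𝐒_y` (`stagSpinStructure_eq_spinSq_sub`) and, for `x ∈ A`, `y ∈ B`,
`𝐒_x·𝐒_y = ½(S⁺_x S⁻_y + S⁻_x S⁺_y) + S^z_x S^z_y`: the two transverse terms have non-positive
expectation in `ψ₀` by the sector sign rule (`ε_x ε_y = -1`; `S⁻_x S⁺_y = S⁺_y S⁻_x`), and the
longitudinal block `Σ_{x∈A,y∈B} S^z_x S^z_y = S^z_A S^z_B` has expectation `-‖S^z_A ψ₀‖² ≤ 0` because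
`S^z ψ₀ = (S^z_A + S^z_B) ψ₀ = 0` (`re_expect_crossBlock_nonpos`). Hence
`Re⟨ψ₀, 𝓢_A ψ₀⟩ ≥ Re⟨ψ₀, S² ψ₀⟩ = S₀(S₀+1)‖ψ₀‖²` by Lieb's Theorem 2
(`lieb_repulsive_halfFilling_holds`). No isotropy / multiplet averaging is needed for the `S^z = 0`
member; for the other members of the ground multiplet the same floor holds since `𝓢_A` is an
`SU(2)` scalar — TODO(general member): not formalised here (needs the multiplet trace).

## What is cited and what is read

Shen–Qiu–Tian, PRL 72 (1994) 1280 is paywalled (acquisition `acq-07059` open); its statements are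
taken from the held secondary sources: Tasaki, J. Phys.: Condens. Matter 10 (1998) 4353, Theorem 5.3
and §5.3 (`paper:arxiv-cond-mat_9512169` p. 11: "It is also possible to consider order parameters to
see the order is indeed ferrimagnetic [ShenQiuTian94]"), and Miyao, arXiv:1712.05529 §3.4
(Definition 3.8, Proposition 3.9: ferromagnetism of the ground state ⇒ LRO[`p = 0`]) and §6.5
("Shen, Qiu and Tian proved that ferromagnetic and antiferromagnetic long-range orders coexist in the
ground state of the Hubbard model").

## References

* E. H. Lieb, *Two theorems on the Hubbard model*, Phys. Rev. Lett. 62 (1989) 1201; Erratum 62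
  (1989) 1927 — Theorem 2 and the ferrimagnetism remark. [LiebPRL1989]
* S.-Q. Shen, Z.-M. Qiu, G.-S. Tian, *Ferrimagnetic long-range order of the Hubbard model*,
  Phys. Rev. Lett. 72 (1994) 1280–1282 — Theorem and eqs. (7)–(9). [ShenQiuTian1994]
* H. Tasaki, *The Hubbard model — an introduction and selected rigorous results*, J. Phys.:
  Condens. Matter 10 (1998) 4353, §5 Theorem 5.3 and §5.3. [Tasaki1998]
* T. Miyao, *Stability of ferromagnetism in many-electron systems*, arXiv:1712.05529
  (J. Stat. Phys. 176 (2019) 1211), Definition 3.8, Proposition 3.9, §6.5. [Miyao2017]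
* G.-S. Tian, *Lieb's spin-reflection-positivity method and its applications to strongly
  correlated electron systems*, J. Stat. Phys. 116 (2004) 629–680, §3. [Tian2004]
-/

noncomputable section

namespace Literature.MathematicalPhysics.QuantumLattice

open Matrix Finset LiebThm1 FermionSpinMoment
open scoped ComplexOrder MatrixOrder

namespace LiebTwo

/-! ### Private linear-algebra helpers (copies of the private lemmas of
`GroundStateSpinReflectionPositivityHubbard`) -/

section Helpers

variable {Λ : Type*} [LinearOrder Λ] [Fintype Λ]

/-- The word matrices are real. [folklore] -/
private theorem star_wordMatrix_apply' (l : List (Λ × Λ)) (s u : Finset Λ) :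
    star (wordMatrix l s u) = wordMatrix l s u := by
  induction l generalizing s u with
  | nil =>
    rw [wordMatrix, List.map_nil, List.prod_nil, Matrix.one_apply]
    split_ifs <;> simp
  | cons p l ih =>
    have h : wordMatrix (p :: l) = (creation p.1 * annihilation p.2) * wordMatrix l := by
      rw [wordMatrix, List.map_cons, List.prod_cons]; rfl
    rw [h, Matrix.mul_apply, star_sum]
    exact Finset.sum_congr rfl fun c _ => by
      rw [star_mul', LiebThm1.star_creation_mul_annihilation_apply, ih]

/-- `X(l)ᴴ = X(l)ᵀ`. [folklore] -/
private theorem wordMatrix_conjTranspose' (l : List (Λ × Λ)) : (wordMatrix l)ᴴ = (wordMatrix l)ᵀ := by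
  ext s u; rw [conjTranspose_apply, transpose_apply, star_wordMatrix_apply']

variable {μ : Type*} [Fintype μ] [DecidableEq μ]

/-- For `M ⪰ 0` and real matrices `X_b`, `[Tr (Mᴴ X_a M X_bᵀ)]_{ab}` is a Gram matrix, hence
positive semidefinite. [folklore] -/
private theorem posSemidef_hsInner_sandwich' {M : Matrix μ μ ℂ} (hM : M.PosSemidef) {κ : Type*}
    [Fintype κ] (X : κ → Matrix μ μ ℂ) (hX : ∀ b, (X b)ᴴ = (X b)ᵀ) :
    (Matrix.of fun a b : κ => hsInner M (X a * M * (X b)ᵀ)).PosSemidef := by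
  obtain ⟨B, hB⟩ := CStarAlgebra.nonneg_iff_eq_star_mul_self.mp hM.nonneg
  rw [Matrix.star_eq_conjTranspose] at hB
  have hMh : Mᴴ = M := hM.1
  have hentry : ∀ a b, hsInner M (X a * M * (X b)ᵀ) =
      ((Matrix.of fun (a : κ) (ij : μ × μ) => (B * X a * Bᴴ) ij.1 ij.2) *
        (Matrix.of fun (a : κ) (ij : μ × μ) => (B * X a * Bᴴ) ij.1 ij.2)ᴴ) a b := by
    intro a b
    calc hsInner M (X a * M * (X b)ᵀ)
        = (M * (X a * M * (X b)ᴴ)).trace := by rw [hsInner, hMh, ← hX b]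
      _ = (Bᴴ * (B * X a * Bᴴ * B * (X b)ᴴ)).trace := by rw [hB]; simp only [Matrix.mul_assoc]
      _ = ((B * X a * Bᴴ * B * (X b)ᴴ) * Bᴴ).trace := Matrix.trace_mul_comm _ _
      _ = ((B * X a * Bᴴ) * (B * X b * Bᴴ)ᴴ).trace := by
          simp only [conjTranspose_mul, conjTranspose_conjTranspose, Matrix.mul_assoc]
      _ = ∑ i, ∑ j, (B * X a * Bᴴ) i j * star ((B * X b * Bᴴ) i j) := by
          simp only [Matrix.trace, Matrix.diag_apply, Matrix.mul_apply, conjTranspose_apply]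
      _ = _ := by
          rw [Matrix.mul_apply, Fintype.sum_prod_type]
          simp only [Matrix.of_apply, conjTranspose_apply]
  have hmat : (Matrix.of fun a b : κ => hsInner M (X a * M * (X b)ᵀ)) =
      (Matrix.of fun (a : κ) (ij : μ × μ) => (B * X a * Bᴴ) ij.1 ij.2) *
        (Matrix.of fun (a : κ) (ij : μ × μ) => (B * X a * Bᴴ) ij.1 ij.2)ᴴ := by
    ext a b; rw [Matrix.of_apply, hentry]
  rw [hmat]
  exact Matrix.posSemidef_self_mul_conjTranspose _

/-- `Σ_ab G_ab F_ab ≥ 0` for `G, F ⪰ 0` (Schur pairing). [folklore] -/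
private theorem sum_sum_mul_nonneg_of_posSemidef' {κ : Type*} [Fintype κ] {Gm F : Matrix κ κ ℂ}
    (hG : Gm.PosSemidef) (hF : F.PosSemidef) : 0 ≤ ∑ a, ∑ b, Gm a b * F a b := by
  classical
  obtain ⟨B, hB⟩ := CStarAlgebra.nonneg_iff_eq_star_mul_self.mp hG.nonneg
  have hprod : ∀ a b : κ, Gm a b = ∑ k, star (B k a) * B k b := by
    intro a b
    rw [hB, Matrix.star_eq_conjTranspose, Matrix.mul_apply]
    exact Finset.sum_congr rfl fun k _ => by rw [conjTranspose_apply]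
  have key : ∑ a, ∑ b, Gm a b * F a b = ∑ k, star (B k) ⬝ᵥ (F *ᵥ B k) := by
    simp only [dotProduct, mulVec, Pi.star_apply, Finset.mul_sum, hprod, Finset.sum_mul]
    calc ∑ a, ∑ b, ∑ k, star (B k a) * B k b * F a b
        = ∑ a, ∑ k, ∑ b, star (B k a) * B k b * F a b :=
          Finset.sum_congr rfl fun a _ => Finset.sum_comm
      _ = ∑ k, ∑ a, ∑ b, star (B k a) * B k b * F a b := Finset.sum_comm
      _ = ∑ k, ∑ a, ∑ b, star (B k a) * (F a b * B k b) :=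
          Finset.sum_congr rfl fun k _ => Finset.sum_congr rfl fun a _ =>
            Finset.sum_congr rfl fun b _ => by ring
  rw [key]
  exact Finset.sum_nonneg fun k _ => hF.dotProduct_mulVec_nonneg _

omit [LinearOrder Λ] in
/-- `ext_n W ⪰ 0` for `W ⪰ 0`. [folklore] -/
private theorem posSemidef_extMatrix' (n : ℕ) {W : Matrix (Config Λ n) (Config Λ n) ℂ}
    (hW : W.PosSemidef) : (extMatrix n W).PosSemidef := by
  refine Matrix.PosSemidef.of_dotProduct_mulVec_nonneg ?_ fun v => ?_
  · ext a b
    rw [conjTranspose_apply]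
    by_cases h : b.card = n ∧ a.card = n
    · have h1 := extMatrix_apply_coe n W ⟨b, h.1⟩ ⟨a, h.2⟩
      have h2 := extMatrix_apply_coe n W ⟨a, h.2⟩ ⟨b, h.1⟩
      simp only at h1 h2
      rw [h1, h2]
      exact hW.1.apply _ _
    · rw [extMatrix_apply_of_not n W h, extMatrix_apply_of_not n W (fun h' => h ⟨h'.2, h'.1⟩),
        star_zero]
  · have h : star v ⬝ᵥ extMatrix n W *ᵥ v =
        star (fun α : Config Λ n => v α.1) ⬝ᵥ W *ᵥ fun α => v α.1 := by
      simp only [dotProduct, mulVec, Pi.star_apply]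
      rw [← sum_config_eq_sum n (fun a => star (v a) * ∑ b, extMatrix n W a b * v b)]
      · refine Finset.sum_congr rfl fun α _ => ?_
        congr 1
        rw [← sum_config_eq_sum n (fun b => extMatrix n W α.1 b * v b)]
        · exact Finset.sum_congr rfl fun β _ => by rw [extMatrix_apply_coe]
        · intro b hb; rw [extMatrix_apply_of_not n W (fun h => hb h.2), zero_mul]
      · intro a ha
        rw [Finset.sum_eq_zero (fun b _ => ?_), mul_zero]
        rw [extMatrix_apply_of_not n W (fun h => ha h.1), zero_mul]
    rw [h]; exact hW.dotProduct_mulVec_nonneg _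

end Helpers

/-! ### Spin-reflection positivity in every `(N↑, N↓)` sector at half filling -/

section SectorGram

variable {Λ : Type*} [LinearOrder Λ] [Fintype Λ] {G : SimpleGraph Λ} [DecidableRel G.Adj]

/-- **Lieb's Gram block in every sector.** On a connected bipartite graph (colour class `A`, any
`|A|, |B|`), `t ≠ 0`, `U > 0`: for the lowest state `ψ` of `H` in the coordinate sector
`(N↑, N↓) = (p, q)`, `p + q = |Λ|` (an eigenvector in the sector with the sector energy
`E(p, q) = H.minEnergyOn (szSector (p+q) ((p-q)/2))`), every Shiba sign `ε`
(`ε_x ε_y = memSign A x · memSign A y`) and every finite family of words `w`, the matrix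
`[⟨ψ, u(w a) d̃_ε(w b) ψ⟩]_{ab}` is positive semidefinite (a Gram matrix: `ψ = c Φ(W₀)` with
`W₀ ≻ 0`). [cite: LiebPRL1989, proof of Theorem 2] [cite: Tian2004, §3] -/
theorem liebGram_posSemidef_sector (hG : G.Connected) (A : Finset Λ)
    (hA : ∀ x y : Λ, G.Adj x y → (x ∈ A ↔ y ∉ A)) {t U : ℝ} (ht : t ≠ 0) (hU : 0 < U)
    {p q : ℕ} (hpq : p + q = Fintype.card Λ)
    {ε : Λ → ℂ} (hε : ∀ x y, ε x * ε y = memSign A x * memSign A y)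
    {ψ : Fock (Orb Λ)} (hψ : IsInSector p q ψ)
    (hHψ : hamiltonian G t U *ᵥ ψ =
      (((hamiltonian G t U).minEnergyOn (szSector (p + q) (((p : ℝ) - q) / 2)) : ℝ) : ℂ) • ψ)
    {κ : Type*} [Fintype κ] (w : κ → List (Λ × Λ)) :
    (Matrix.of fun a b : κ =>
      star ψ ⬝ᵥ ((upWord (w a) * shibaDownWord ε (w b)) *ᵥ ψ)).PosSemidef := by
  classical
  obtain ⟨W₀, hW₀pd, -, -, huniq⟩ := halfFilled_upDownSector_groundState G hG A hA ht hU hpq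
  obtain ⟨c, rfl⟩ := huniq ψ hψ hHψ
  have hMpsd : (extMatrix p W₀).PosSemidef := posSemidef_extMatrix' p hW₀pd.posSemidef
  have hF := posSemidef_hsInner_sandwich' hMpsd (fun a => wordMatrix (w a))
    (fun b => wordMatrix_conjTranspose' (w b))
  have hentry : ∀ a b, star (c • toFockN A p W₀) ⬝ᵥ
      ((upWord (w a) * shibaDownWord ε (w b)) *ᵥ (c • toFockN A p W₀)) =
        star c * hsInner (extMatrix p W₀)
          (wordMatrix (w a) * extMatrix p W₀ * (wordMatrix (w b))ᵀ) * c := by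
    intro a b
    rw [mulVec_smul, star_smul, smul_dotProduct, dotProduct_smul, toFockN,
      star_toFock_dotProduct_upWord_mul_shibaDownWord_mulVec A hε, smul_eq_mul, smul_eq_mul]
    ring
  have hmat : (Matrix.of fun a b : κ => star (c • toFockN A p W₀) ⬝ᵥ
      ((upWord (w a) * shibaDownWord ε (w b)) *ᵥ (c • toFockN A p W₀))) =
      (diagonal fun _ : κ => c)ᴴ *
        (Matrix.of fun a b : κ => hsInner (extMatrix p W₀)
          (wordMatrix (w a) * extMatrix p W₀ * (wordMatrix (w b))ᵀ)) *
        diagonal fun _ : κ => c := by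
    ext a b
    rw [diagonal_conjTranspose, Matrix.mul_diagonal, Matrix.diagonal_mul, Matrix.of_apply,
      Matrix.of_apply, hentry, Pi.star_apply]
  rw [hmat]
  exact hF.conjTranspose_mul_mul_same _

/-- **The Lieb form is nonnegative in every sector's lowest state** (`G ⪰ 0` a dual matrix):
`0 ≤ ⟨ψ, Σ_ab G_ab u(w a) d̃_ε(w b) ψ⟩`. [cite: LiebPRL1989, proof of Theorem 2] [cite: KullEtAl2024, §5.3] -/
theorem liebForm_expect_nonneg_sector (hG : G.Connected) (A : Finset Λ)
    (hA : ∀ x y : Λ, G.Adj x y → (x ∈ A ↔ y ∉ A)) {t U : ℝ} (ht : t ≠ 0) (hU : 0 < U)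
    {p q : ℕ} (hpq : p + q = Fintype.card Λ)
    {ε : Λ → ℂ} (hε : ∀ x y, ε x * ε y = memSign A x * memSign A y)
    {ψ : Fock (Orb Λ)} (hψ : IsInSector p q ψ)
    (hHψ : hamiltonian G t U *ᵥ ψ =
      (((hamiltonian G t U).minEnergyOn (szSector (p + q) (((p : ℝ) - q) / 2)) : ℝ) : ℂ) • ψ)
    {κ : Type*} [Fintype κ] {Gm : Matrix κ κ ℂ} (hGm : Gm.PosSemidef) (w : κ → List (Λ × Λ)) :
    0 ≤ star ψ ⬝ᵥ liebForm ε Gm w *ᵥ ψ := by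
  classical
  have h : star ψ ⬝ᵥ liebForm ε Gm w *ᵥ ψ =
      ∑ a, ∑ b, Gm a b * (Matrix.of fun a b : κ =>
        star ψ ⬝ᵥ ((upWord (w a) * shibaDownWord ε (w b)) *ᵥ ψ)) a b := by
    simp only [liebForm, Matrix.sum_mulVec, dotProduct_sum, Matrix.smul_mulVec, dotProduct_smul,
      smul_eq_mul, Matrix.of_apply]
  rw [h]
  exact sum_sum_mul_nonneg_of_posSemidef' hGm
    (liebGram_posSemidef_sector hG A hA ht hU hpq hε hψ hHψ w)

/-- **The Shen–Qiu–Tian transverse sign rule in every sector.** For the lowest state `ψ` of the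
sector `(p, q)`, `p + q = |Λ|`, and all sites `x, y`: `ε_x ε_y ⟨ψ, S⁺_x S⁻_y ψ⟩ ≥ 0`
(`ε = stagSign A = ±1`), i.e. the transverse spin correlation is non-negative on equal and
non-positive on opposite sublattices. [cite: ShenQiuTian1994, Theorem and eqs. (7)–(9)]
[cite: Tasaki1998, Theorem 5.3] -/
theorem sector_sign_rule (hG : G.Connected) (A : Finset Λ)
    (hA : ∀ x y : Λ, G.Adj x y → (x ∈ A ↔ y ∉ A)) {t U : ℝ} (ht : t ≠ 0) (hU : 0 < U)
    {p q : ℕ} (hpq : p + q = Fintype.card Λ) {ψ : Fock (Orb Λ)} (hψ : IsInSector p q ψ)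
    (hHψ : hamiltonian G t U *ᵥ ψ =
      (((hamiltonian G t U).minEnergyOn (szSector (p + q) (((p : ℝ) - q) / 2)) : ℝ) : ℂ) • ψ)
    (x y : Λ) :
    0 ≤ stagSign A x * stagSign A y * (star ψ ⬝ᵥ ((fermionSpinPlus x * fermionSpinMinus y) *ᵥ ψ)) := by
  classical
  have h := liebForm_expect_nonneg_sector hG A hA ht hU hpq (stagSign_mul_stagSign_eq_memSign A) hψ
    hHψ (Gm := (1 : Matrix Unit Unit ℂ)) Matrix.PosSemidef.one (fun _ => [(x, y)])
  have hform : liebForm (stagSign A) (1 : Matrix Unit Unit ℂ) (fun _ => [(x, y)]) =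
      (stagSign A x * stagSign A y) • (fermionSpinPlus x * fermionSpinMinus y) := by
    simp [liebForm, upWord_pair_mul_shibaDownWord_pair]
  rwa [hform, Matrix.smul_mulVec, dotProduct_smul, smul_eq_mul] at h

/-- Real-part form of the sector sign rule: `0 ≤ ε_x ε_y Re ⟨ψ, S⁺_x S⁻_y ψ⟩`.
[cite: ShenQiuTian1994, Theorem and eqs. (7)–(9)] -/
theorem sector_sign_rule_re (hG : G.Connected) (A : Finset Λ)
    (hA : ∀ x y : Λ, G.Adj x y → (x ∈ A ↔ y ∉ A)) {t U : ℝ} (ht : t ≠ 0) (hU : 0 < U)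
    {p q : ℕ} (hpq : p + q = Fintype.card Λ) {ψ : Fock (Orb Λ)} (hψ : IsInSector p q ψ)
    (hHψ : hamiltonian G t U *ᵥ ψ =
      (((hamiltonian G t U).minEnergyOn (szSector (p + q) (((p : ℝ) - q) / 2)) : ℝ) : ℂ) • ψ)
    (x y : Λ) :
    0 ≤ ((stagSign A x * stagSign A y) *
      (star ψ ⬝ᵥ ((fermionSpinPlus x * fermionSpinMinus y) *ᵥ ψ))).re :=
  (Complex.nonneg_iff.mp (sector_sign_rule hG A hA ht hU hpq hψ hHψ x y)).1

end SectorGram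

end LiebTwo

/-! ### Operator identities: the cross block of the staggered structure operator -/

section Operators

open LiebTwo

variable {Λ : Type*} [LinearOrder Λ] [Fintype Λ]

/-- `S⁻_x S⁺_y = S⁺_y S⁻_x` for distinct sites (CAR). [cite: EsslerEtAl2005, §2.2.5 eq. (2.66)] -/
theorem fermionSpinMinus_mul_fermionSpinPlus_of_ne {x y : Λ} (hxy : x ≠ y) :
    fermionSpinMinus x * fermionSpinPlus y = fermionSpinPlus y * fermionSpinMinus x := by
  have h00 : orb x 0 ≠ orb y 0 := fun h => hxy (orb_inj.1 h).1
  have h11 : orb y 1 ≠ orb x 1 := fun h => hxy (orb_inj.1 h).1.symm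
  rw [fermionSpinMinus_def, fermionSpinPlus_def,
    creation_annihilation_mul_creation_annihilation_of_ne h00,
    creation_annihilation_mul_creation_annihilation_of_ne h11,
    creation_creation_annihilation_annihilation_swap (orb y 0) (orb x 1)]

/-- **The staggered structure operator versus the total spin**:
`𝓢_A = S² - 2(Σ_{x∈A,y∈Aᶜ} + Σ_{x∈Aᶜ,y∈A}) 𝐒_x·𝐒_y`. [cite: LiebPRL1989, Theorem 2] -/
theorem stagSpinStructure_eq_spinSq_sub (A : Finset Λ) :
    stagSpinStructure A = spinSq -
      (2 : ℂ) • ((∑ x ∈ A, ∑ y ∈ Aᶜ, fermionSpinDot x y) + ∑ x ∈ Aᶜ, ∑ y ∈ A, fermionSpinDot x y) := by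
  have hin : ∀ x : Λ, ∑ y, fermionSpinDot x y =
      ∑ y ∈ A, fermionSpinDot x y + ∑ y ∈ Aᶜ, fermionSpinDot x y :=
    fun x => (Finset.sum_add_sum_compl A _).symm
  have hall : (∑ x : Λ, ∑ y : Λ, fermionSpinDot x y) =
      (∑ x ∈ A, ∑ y ∈ A, fermionSpinDot x y + ∑ x ∈ A, ∑ y ∈ Aᶜ, fermionSpinDot x y) +
        (∑ x ∈ Aᶜ, ∑ y ∈ A, fermionSpinDot x y + ∑ x ∈ Aᶜ, ∑ y ∈ Aᶜ, fermionSpinDot x y) := by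
    rw [← Finset.sum_add_sum_compl A (fun x => ∑ y, fermionSpinDot x y)]
    simp only [hin, Finset.sum_add_distrib]
  rw [stagSpinStructure_eq, ← sum_sum_fermionSpinDot, hall]
  module

/-- The two cross blocks coincide: `Σ_{x∈Aᶜ,y∈A} 𝐒_x·𝐒_y = Σ_{x∈A,y∈Aᶜ} 𝐒_x·𝐒_y`
(`𝐒_x·𝐒_y = 𝐒_y·𝐒_x`). [cite: EsslerEtAl2005, §2.2.5 eq. (2.66)] -/
theorem sum_compl_sum_fermionSpinDot_eq (A : Finset Λ) :
    ∑ x ∈ Aᶜ, ∑ y ∈ A, fermionSpinDot x y = ∑ x ∈ A, ∑ y ∈ Aᶜ, fermionSpinDot x y := by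
  rw [Finset.sum_comm]
  exact Finset.sum_congr rfl fun x _ => Finset.sum_congr rfl fun y _ => fermionSpinDot_comm y x

/-- `𝓢_A = S² - 4 Σ_{x∈A,y∈Aᶜ} 𝐒_x·𝐒_y`. [cite: LiebPRL1989, Theorem 2] -/
theorem stagSpinStructure_eq_spinSq_sub_four (A : Finset Λ) :
    stagSpinStructure A = spinSq - (4 : ℂ) • ∑ x ∈ A, ∑ y ∈ Aᶜ, fermionSpinDot x y := by
  rw [stagSpinStructure_eq_spinSq_sub, sum_compl_sum_fermionSpinDot_eq]
  module

/-- **The cross block**: `Σ_{x∈A,y∈Aᶜ} 𝐒_x·𝐒_y = ½ Σ_{x∈A,y∈Aᶜ}(S⁺_x S⁻_y + S⁻_x S⁺_y) + S^z_A S^z_{Aᶜ}`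
with `S^z_Y = Σ_{x∈Y} S^z_x`. [cite: EsslerEtAl2005, §2.2.5 eq. (2.66)] -/
theorem crossBlock_eq (A : Finset Λ) :
    ∑ x ∈ A, ∑ y ∈ Aᶜ, fermionSpinDot x y =
      (1 / 2 : ℂ) • (∑ x ∈ A, ∑ y ∈ Aᶜ,
        (fermionSpinPlus x * fermionSpinMinus y + fermionSpinMinus x * fermionSpinPlus y)) +
      (∑ x ∈ A, fermionSpinZ x) * ∑ y ∈ Aᶜ, fermionSpinZ y := by
  simp only [fermionSpinDot, Finset.sum_add_distrib, Finset.sum_mul_sum, ← Finset.smul_sum]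

/-- `S^z_A + S^z_{Aᶜ} = S^z`. [cite: EsslerEtAl2005, §2.2.5 eq. (2.66)] -/
theorem sum_fermionSpinZ_add_sum_compl (A : Finset Λ) :
    (∑ x ∈ A, fermionSpinZ x) + ∑ x ∈ Aᶜ, fermionSpinZ x =
      (HubbardWave0.spinZ : Matrix (Finset (Orb Λ)) (Finset (Orb Λ)) ℂ) := by
  rw [Finset.sum_add_sum_compl, sum_fermionSpinZ]

/-- A partial sum of local `S^z` is Hermitian. [cite: EsslerEtAl2005, §2.2.5 eq. (2.66)] -/
theorem conjTranspose_sum_fermionSpinZ (Y : Finset Λ) :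
    (∑ x ∈ Y, fermionSpinZ x)ᴴ = ∑ x ∈ Y, (fermionSpinZ x : Matrix (Finset (Orb Λ)) _ ℂ) := by
  rw [Matrix.conjTranspose_sum]
  exact Finset.sum_congr rfl fun x _ => conjTranspose_fermionSpinZ x

/-- **The longitudinal cross block is non-positive on `S^z = 0` vectors**:
if `S^z ψ = 0` then `⟨ψ, S^z_A S^z_{Aᶜ} ψ⟩ = -‖S^z_A ψ‖² ≤ 0`. [cite: ShenQiuTian1994, Theorem and eqs. (7)–(9)] -/
theorem expect_sumSpinZ_mul_sumSpinZ_compl_of_spinZ_zero (A : Finset Λ) {ψ : Fock (Orb Λ)}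
    (hZ : HubbardWave0.spinZ *ᵥ ψ = 0) :
    star ψ ⬝ᵥ (((∑ x ∈ A, fermionSpinZ x) * ∑ y ∈ Aᶜ, fermionSpinZ y) *ᵥ ψ) =
      -(star ((∑ x ∈ A, fermionSpinZ x) *ᵥ ψ) ⬝ᵥ ((∑ x ∈ A, fermionSpinZ x) *ᵥ ψ)) := by
  set ZA : Matrix (Finset (Orb Λ)) (Finset (Orb Λ)) ℂ := ∑ x ∈ A, fermionSpinZ x with hZA
  set ZB : Matrix (Finset (Orb Λ)) (Finset (Orb Λ)) ℂ := ∑ x ∈ Aᶜ, fermionSpinZ x with hZB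
  have hsum : ZA + ZB = HubbardWave0.spinZ := sum_fermionSpinZ_add_sum_compl A
  have hZBψ : ZB *ᵥ ψ = -(ZA *ᵥ ψ) := by
    have h : (ZA + ZB) *ᵥ ψ = 0 := by rw [hsum, hZ]
    rw [add_mulVec] at h
    exact eq_neg_of_add_eq_zero_right h
  have hherm : ZAᴴ = ZA := conjTranspose_sum_fermionSpinZ A
  rw [← mulVec_mulVec, hZBψ, mulVec_neg, dotProduct_neg, dotProduct_mulVec, star_mulVec, hherm]

/-- Real-part form: `Re ⟨ψ, S^z_A S^z_{Aᶜ} ψ⟩ ≤ 0` when `S^z ψ = 0`. [cite: ShenQiuTian1994, Theorem and eqs. (7)–(9)] -/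
theorem re_expect_sumSpinZ_mul_sumSpinZ_compl_nonpos (A : Finset Λ) {ψ : Fock (Orb Λ)}
    (hZ : HubbardWave0.spinZ *ᵥ ψ = 0) :
    (star ψ ⬝ᵥ (((∑ x ∈ A, fermionSpinZ x) * ∑ y ∈ Aᶜ, fermionSpinZ y) *ᵥ ψ)).re ≤ 0 := by
  rw [expect_sumSpinZ_mul_sumSpinZ_compl_of_spinZ_zero A hZ, Complex.neg_re, neg_nonpos]
  exact (Complex.nonneg_iff.mp (dotProduct_star_self_nonneg _)).1

end Operators

/-! ### The `S^z = 0` ground state at half filling: existence, uniqueness, the sign rule -/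

section SzZero

open LiebTwo

variable {Λ : Type*} [LinearOrder Λ] [Fintype Λ] {G : SimpleGraph Λ} [DecidableRel G.Adj]

/-- The central joint sector written two ways: `szSector (n+n) ((n-n)/2) = szSector (2n) 0`. [folklore] -/
private theorem szSector_central_eq (n : ℕ) :
    (szSector (n + n) (((n : ℝ) - n) / 2) : Submodule ℂ (Fock (Orb Λ))) = szSector (2 * n) 0 := by
  rw [sub_self, zero_div, two_mul]

/-- A half-filled vector with `S^z ψ = 0` lies in the central coordinate sector `(n, n)`,
`|Λ| = 2n`. Lieb, PRL 62 (1989) 1201, proof of Theorem 2 (`S^z = 0`). [cite: LiebPRL1989, proof of Theorem 2] -/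
theorem isInSector_of_spinZ_zero {n : ℕ} (hΛ : Fintype.card Λ = n + n) {ψ : Fock (Orb Λ)}
    (hN : IsNParticle (Fintype.card Λ) ψ) (hZ : HubbardWave0.spinZ *ᵥ ψ = 0) : IsInSector n n ψ := by
  rw [← mem_szSector_iff_isInSector, mem_szSector_iff]
  refine ⟨by rw [← hΛ]; exact hN, ?_⟩
  rw [hZ, sub_self, zero_div, Complex.ofReal_zero, zero_smul]

/-- **The sector energy of the central sector is the half-filled ground energy**, so a half-filled
ground state with `S^z ψ = 0` is the lowest state of the sector `(n, n)` in the sense of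
`liebGram_posSemidef_sector`. [cite: LiebPRL1989, proof of Theorem 2] -/
theorem hamiltonian_mulVec_eq_sectorEnergy_of_spinZ_zero {n : ℕ} (hΛ : Fintype.card Λ = n + n)
    {t U : ℝ} {ψ : Fock (Orb Λ)}
    (hHψ : hamiltonian G t U *ᵥ ψ = ((groundEnergyAt G t U (Fintype.card Λ) : ℝ) : ℂ) • ψ) :
    hamiltonian G t U *ᵥ ψ =
      (((hamiltonian G t U).minEnergyOn (szSector (n + n) (((n : ℝ) - n) / 2)) : ℝ) : ℂ) • ψ := by
  have hn : n ≤ Fintype.card Λ := by rw [hΛ]; omega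
  rw [szSector_central_eq, ← groundEnergyAt_eq_minEnergyOn_szSector G t U hn, two_mul, ← hΛ, hHψ]

/-- **The sign rule for THE `S^z = 0` half-filled ground state, any `|A|, |B|`**:
`ε_x ε_y ⟨ψ, S⁺_x S⁻_y ψ⟩ ≥ 0`. [cite: ShenQiuTian1994, Theorem and eqs. (7)–(9)] [cite: Tasaki1998, Theorem 5.3] -/
theorem szZero_sign_rule (hG : G.Connected) (A : Finset Λ)
    (hA : ∀ x y : Λ, G.Adj x y → (x ∈ A ↔ y ∉ A)) (hΛ : Even (Fintype.card Λ))
    {t U : ℝ} (ht : t ≠ 0) (hU : 0 < U) {ψ : Fock (Orb Λ)} (hN : IsNParticle (Fintype.card Λ) ψ)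
    (hHψ : hamiltonian G t U *ᵥ ψ = ((groundEnergyAt G t U (Fintype.card Λ) : ℝ) : ℂ) • ψ)
    (hZ : HubbardWave0.spinZ *ᵥ ψ = 0) (x y : Λ) :
    0 ≤ stagSign A x * stagSign A y * (star ψ ⬝ᵥ ((fermionSpinPlus x * fermionSpinMinus y) *ᵥ ψ)) := by
  obtain ⟨n, hn⟩ := hΛ
  exact sector_sign_rule hG A hA ht hU hn.symm (isInSector_of_spinZ_zero hn hN hZ)
    (hamiltonian_mulVec_eq_sectorEnergy_of_spinZ_zero hn hHψ) x y

/-- **Existence and uniqueness of the `S^z = 0` half-filled ground state** (any `|A|, |B|`): there is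
a half-filled ground state `ψ₀ ≠ 0` with `S^z ψ₀ = 0`, and every half-filled ground-energy
eigenvector with `S^z φ = 0` is a multiple of it (Lieb's `Φ(W₀)`, `W₀ ≻ 0`, in the central sector;
`E(n, n) = E₀(|Λ|)`). [cite: LiebPRL1989, Theorem 2] -/
theorem exists_szZero_groundState (hG : G.Connected) (A : Finset Λ)
    (hA : ∀ x y : Λ, G.Adj x y → (x ∈ A ↔ y ∉ A)) (hΛ : Even (Fintype.card Λ))
    {t U : ℝ} (ht : t ≠ 0) (hU : 0 < U) :
    ∃ ψ₀ : Fock (Orb Λ), IsGroundState (hamiltonian G t U) (Fintype.card Λ) ψ₀ ∧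
      HubbardWave0.spinZ *ᵥ ψ₀ = 0 ∧
      ∀ φ : Fock (Orb Λ), IsNParticle (Fintype.card Λ) φ →
        hamiltonian G t U *ᵥ φ = ((groundEnergyAt G t U (Fintype.card Λ) : ℝ) : ℂ) • φ →
        HubbardWave0.spinZ *ᵥ φ = 0 → ∃ c : ℂ, φ = c • ψ₀ := by
  obtain ⟨n, hn⟩ := hΛ
  have hle : n ≤ Fintype.card Λ := by rw [hn]; omega
  obtain ⟨W₀, -, hne, hH, huniq⟩ := halfFilled_upDownSector_groundState G hG A hA ht hU hn.symm
  have hsec : IsInSector n n (toFockN A n W₀) := isInSector_toFockN A hn.symm W₀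
  have hE : (hamiltonian G t U).minEnergyOn (szSector (n + n) (((n : ℝ) - n) / 2)) =
      groundEnergyAt G t U (Fintype.card Λ) := by
    rw [szSector_central_eq, ← groundEnergyAt_eq_minEnergyOn_szSector G t U hle, two_mul, ← hn]
  refine ⟨toFockN A n W₀, ⟨?_, hne, ?_⟩, ?_, fun φ hφN hφH hφZ => ?_⟩
  · have h := hsec.isNParticle; rwa [← hn] at h
  · rw [hH, hE]; rfl
  · rw [spinZ_mulVec_of_isInSector hsec, sub_self, mul_zero, zero_smul]
  · exact huniq φ (isInSector_of_spinZ_zero hn hφN hφZ)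
      (hamiltonian_mulVec_eq_sectorEnergy_of_spinZ_zero hn hφH)

end SzZero

/-! ### Lieb's ferrimagnetism: the uniform structure factor of every half-filled ground state -/

section Ferrimagnetism

open LiebTwo

variable {Λ : Type*} [LinearOrder Λ] [Fintype Λ] {G : SimpleGraph Λ} [DecidableRel G.Adj]

/-- **Lieb's Theorem 2, spin of every half-filled ground state** (`S² ψ = S₀(S₀+1) ψ`,
`S₀ = liebSpin A = ||A| - |B||/2`), unpacked from `lieb_repulsive_halfFilling_holds`.
[cite: LiebPRL1989, Theorem 2] -/
theorem spinSq_mulVec_of_isGroundState (hG : G.Connected) (A : Finset Λ)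
    (hA : ∀ x y : Λ, G.Adj x y → (x ∈ A ↔ y ∉ A)) (hΛ : Even (Fintype.card Λ))
    {t U : ℝ} (ht : t ≠ 0) (hU : 0 < U) {ψ : Fock (Orb Λ)}
    (hψ : IsGroundState (hamiltonian G t U) (Fintype.card Λ) ψ) :
    spinSq *ᵥ ψ = ((liebSpin A * (liebSpin A + 1) : ℝ) : ℂ) • ψ :=
  (lieb_repulsive_halfFilling_holds G hG A hA hΛ t U ht hU (Fintype.card Λ) rfl).1 ψ hψ

/-- **Lieb's ferrimagnetism — the uniform spin structure factor of every half-filled ground state**: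
`⟨ψ, (Σ_{x,y} 𝐒_x·𝐒_y) ψ⟩ = S₀(S₀+1) ‖ψ‖²`. [cite: LiebPRL1989, Theorem 2] [cite: Miyao2017, Proposition 3.9] -/
theorem expect_sum_sum_fermionSpinDot_eq_of_isGroundState (hG : G.Connected) (A : Finset Λ)
    (hA : ∀ x y : Λ, G.Adj x y → (x ∈ A ↔ y ∉ A)) (hΛ : Even (Fintype.card Λ))
    {t U : ℝ} (ht : t ≠ 0) (hU : 0 < U) {ψ : Fock (Orb Λ)}
    (hψ : IsGroundState (hamiltonian G t U) (Fintype.card Λ) ψ) :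
    star ψ ⬝ᵥ ((∑ x, ∑ y, fermionSpinDot x y) *ᵥ ψ) =
      ((liebSpin A * (liebSpin A + 1) : ℝ) : ℂ) * (star ψ ⬝ᵥ ψ) := by
  rw [sum_sum_fermionSpinDot, spinSq_mulVec_of_isGroundState hG A hA hΛ ht hU hψ, dotProduct_smul,
    smul_eq_mul]

/-- Real-part form of Lieb's ferrimagnetism: `Re ⟨ψ, (Σ_{x,y} 𝐒_x·𝐒_y) ψ⟩ = S₀(S₀+1) ‖ψ‖²`.
[cite: LiebPRL1989, Theorem 2] [cite: Tasaki1998, §5.3] -/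
theorem re_expect_sum_sum_fermionSpinDot_eq_of_isGroundState (hG : G.Connected) (A : Finset Λ)
    (hA : ∀ x y : Λ, G.Adj x y → (x ∈ A ↔ y ∉ A)) (hΛ : Even (Fintype.card Λ))
    {t U : ℝ} (ht : t ≠ 0) (hU : 0 < U) {ψ : Fock (Orb Λ)}
    (hψ : IsGroundState (hamiltonian G t U) (Fintype.card Λ) ψ) :
    (star ψ ⬝ᵥ ((∑ x, ∑ y, fermionSpinDot x y) *ᵥ ψ)).re =
      liebSpin A * (liebSpin A + 1) * (star ψ ⬝ᵥ ψ).re := by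
  rw [expect_sum_sum_fermionSpinDot_eq_of_isGroundState hG A hA hΛ ht hU hψ, Complex.re_ofReal_mul]

/-- `S₀² = ¼ (|A| - |B|)²`. [cite: LiebPRL1989, Theorem 2] -/
theorem liebSpin_sq (A : Finset Λ) :
    liebSpin A ^ 2 = ((A.card : ℝ) - (Aᶜ.card : ℝ)) ^ 2 / 4 := by
  rw [liebSpin, div_pow, sq_abs]; norm_num

/-- `0 ≤ S₀`. [cite: LiebPRL1989, Theorem 2] -/
theorem liebSpin_nonneg (A : Finset Λ) : 0 ≤ liebSpin A := by
  unfold liebSpin; positivity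

/-- `¼(|A| - |B|)² ≤ S₀(S₀+1)`. [cite: LiebPRL1989, Theorem 2] -/
theorem sq_card_sub_div_four_le_liebSpin (A : Finset Λ) :
    ((A.card : ℝ) - (Aᶜ.card : ℝ)) ^ 2 / 4 ≤ liebSpin A * (liebSpin A + 1) := by
  rw [← liebSpin_sq]
  have := liebSpin_nonneg A
  nlinarith

/-- **The ferromagnetic floor**: `¼(|A| - |B|)² ‖ψ‖² ≤ Re ⟨ψ, (Σ_{x,y} 𝐒_x·𝐒_y) ψ⟩` for every
half-filled ground state — long-range order with ordering wave vector `0` when `|A| - |B| ∝ |Λ|`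
(e.g. Lieb's `CuO₂` lattice, `|B| = 2|A|`). [cite: LiebPRL1989, Theorem 2] [cite: Miyao2017, Proposition 3.9]
[cite: Tasaki1998, §5.3] -/
theorem liebSpin_sq_le_re_expect_sum_sum_fermionSpinDot (hG : G.Connected) (A : Finset Λ)
    (hA : ∀ x y : Λ, G.Adj x y → (x ∈ A ↔ y ∉ A)) (hΛ : Even (Fintype.card Λ))
    {t U : ℝ} (ht : t ≠ 0) (hU : 0 < U) {ψ : Fock (Orb Λ)}
    (hψ : IsGroundState (hamiltonian G t U) (Fintype.card Λ) ψ) :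
    ((A.card : ℝ) - (Aᶜ.card : ℝ)) ^ 2 / 4 * (star ψ ⬝ᵥ ψ).re ≤
      (star ψ ⬝ᵥ ((∑ x, ∑ y, fermionSpinDot x y) *ᵥ ψ)).re := by
  rw [re_expect_sum_sum_fermionSpinDot_eq_of_isGroundState hG A hA hΛ ht hU hψ]
  exact mul_le_mul_of_nonneg_right (sq_card_sub_div_four_le_liebSpin A)
    (Complex.nonneg_iff.mp (dotProduct_star_self_nonneg ψ)).1

end Ferrimagnetism

/-! ### Shen–Qiu–Tian: the staggered structure factor dominates the uniform one -/

section ShenQiuTian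

open LiebTwo

variable {Λ : Type*} [LinearOrder Λ] [Fintype Λ] {G : SimpleGraph Λ} [DecidableRel G.Adj]

/-- **The cross block is non-positive in the `S^z = 0` ground state**: for THE half-filled
ground state `ψ` with `S^z ψ = 0`, `Re ⟨ψ, (Σ_{x∈A,y∈Aᶜ} 𝐒_x·𝐒_y) ψ⟩ ≤ 0` (transverse terms by the
sector sign rule, longitudinal block `= -‖S^z_A ψ‖²`). [cite: ShenQiuTian1994, Theorem and eqs. (7)–(9)] -/
theorem re_expect_crossBlock_nonpos (hG : G.Connected) (A : Finset Λ)
    (hA : ∀ x y : Λ, G.Adj x y → (x ∈ A ↔ y ∉ A)) (hΛ : Even (Fintype.card Λ))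
    {t U : ℝ} (ht : t ≠ 0) (hU : 0 < U) {ψ : Fock (Orb Λ)} (hN : IsNParticle (Fintype.card Λ) ψ)
    (hHψ : hamiltonian G t U *ᵥ ψ = ((groundEnergyAt G t U (Fintype.card Λ) : ℝ) : ℂ) • ψ)
    (hZ : HubbardWave0.spinZ *ᵥ ψ = 0) :
    (star ψ ⬝ᵥ ((∑ x ∈ A, ∑ y ∈ Aᶜ, fermionSpinDot x y) *ᵥ ψ)).re ≤ 0 := by
  classical
  have hsign := szZero_sign_rule hG A hA hΛ ht hU hN hHψ hZ
  -- the transverse terms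
  have hpm : ∀ x ∈ A, ∀ y ∈ Aᶜ,
      (star ψ ⬝ᵥ ((fermionSpinPlus x * fermionSpinMinus y) *ᵥ ψ)).re ≤ 0 := by
    intro x hx y hy
    have h := (Complex.nonneg_iff.mp (hsign x y)).1
    rw [stagSign_of_mem hx, stagSign_of_mem_compl hy, one_mul, neg_one_mul, Complex.neg_re] at h
    linarith
  have hmp : ∀ x ∈ A, ∀ y ∈ Aᶜ,
      (star ψ ⬝ᵥ ((fermionSpinMinus x * fermionSpinPlus y) *ᵥ ψ)).re ≤ 0 := by
    intro x hx y hy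
    have hxy : x ≠ y := fun h => (Finset.mem_compl.1 hy) (h ▸ hx)
    have h := (Complex.nonneg_iff.mp (hsign y x)).1
    rw [stagSign_of_mem hx, stagSign_of_mem_compl hy, mul_one, neg_one_mul, Complex.neg_re] at h
    rw [fermionSpinMinus_mul_fermionSpinPlus_of_ne hxy]
    linarith
  have htrans : (star ψ ⬝ᵥ ((∑ x ∈ A, ∑ y ∈ Aᶜ,
      (fermionSpinPlus x * fermionSpinMinus y + fermionSpinMinus x * fermionSpinPlus y)) *ᵥ ψ)).re ≤ 0 := by
    rw [Matrix.sum_mulVec, dotProduct_sum, Complex.re_sum]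
    refine Finset.sum_nonpos fun x hx => ?_
    rw [Matrix.sum_mulVec, dotProduct_sum, Complex.re_sum]
    refine Finset.sum_nonpos fun y hy => ?_
    rw [add_mulVec, dotProduct_add, Complex.add_re]
    exact add_nonpos (hpm x hx y hy) (hmp x hx y hy)
  have hlong := re_expect_sumSpinZ_mul_sumSpinZ_compl_nonpos A hZ
  rw [crossBlock_eq, add_mulVec, Matrix.smul_mulVec, dotProduct_add, dotProduct_smul, Complex.add_re,
    smul_eq_mul, show (1 / 2 : ℂ) = ((1 / 2 : ℝ) : ℂ) by push_cast; ring, Complex.re_ofReal_mul]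
  nlinarith

/-- **Shen–Qiu–Tian's ferrimagnetic long-range order (kernel form).** On a connected bipartite graph
with colour class `A` (any `|A|, |B|`, `|Λ|` even), `t ≠ 0`, `U > 0`: THE half-filled ground state
`ψ` with `S^z ψ = 0` satisfies `S₀(S₀+1) ‖ψ‖² ≤ Re ⟨ψ, 𝓢_A ψ⟩` — the staggered spin structure
factor is at least the uniform one (`= S₀(S₀+1)‖ψ‖²`, Lieb), both of order `|Λ|²` when
`|A| - |B| ∝ |Λ|`: antiferromagnetic and ferromagnetic long-range order coexist.
[cite: ShenQiuTian1994, Theorem and eqs. (7)–(9)] [cite: Miyao2017, §6.5] [cite: Tasaki1998, §5.3] -/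
theorem liebSpin_le_re_expect_stagSpinStructure (hG : G.Connected) (A : Finset Λ)
    (hA : ∀ x y : Λ, G.Adj x y → (x ∈ A ↔ y ∉ A)) (hΛ : Even (Fintype.card Λ))
    {t U : ℝ} (ht : t ≠ 0) (hU : 0 < U) {ψ : Fock (Orb Λ)}
    (hψ : IsGroundState (hamiltonian G t U) (Fintype.card Λ) ψ) (hZ : HubbardWave0.spinZ *ᵥ ψ = 0) :
    liebSpin A * (liebSpin A + 1) * (star ψ ⬝ᵥ ψ).re ≤
      (star ψ ⬝ᵥ (stagSpinStructure A *ᵥ ψ)).re := by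
  have hcross := re_expect_crossBlock_nonpos hG A hA hΛ ht hU hψ.1 hψ.2.2 hZ
  have hS := spinSq_mulVec_of_isGroundState hG A hA hΛ ht hU hψ
  rw [stagSpinStructure_eq_spinSq_sub_four, sub_mulVec, Matrix.smul_mulVec, dotProduct_sub,
    dotProduct_smul, hS, dotProduct_smul, smul_eq_mul, smul_eq_mul, Complex.sub_re,
    Complex.re_ofReal_mul, show (4 : ℂ) = ((4 : ℝ) : ℂ) by norm_num, Complex.re_ofReal_mul]
  linarith

/-- **The antiferromagnetic floor**: `¼(|A| - |B|)² ‖ψ‖² ≤ Re ⟨ψ, 𝓢_A ψ⟩` for THE half-filled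
`S^z = 0` ground state — Néel long-range order whenever `|A| - |B| ∝ |Λ|`, for every `U > 0`.
[cite: ShenQiuTian1994, Theorem and eqs. (7)–(9)] [cite: Miyao2017, §6.5] -/
theorem sq_card_sub_le_re_expect_stagSpinStructure (hG : G.Connected) (A : Finset Λ)
    (hA : ∀ x y : Λ, G.Adj x y → (x ∈ A ↔ y ∉ A)) (hΛ : Even (Fintype.card Λ))
    {t U : ℝ} (ht : t ≠ 0) (hU : 0 < U) {ψ : Fock (Orb Λ)}
    (hψ : IsGroundState (hamiltonian G t U) (Fintype.card Λ) ψ) (hZ : HubbardWave0.spinZ *ᵥ ψ = 0) :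
    ((A.card : ℝ) - (Aᶜ.card : ℝ)) ^ 2 / 4 * (star ψ ⬝ᵥ ψ).re ≤
      (star ψ ⬝ᵥ (stagSpinStructure A *ᵥ ψ)).re :=
  le_trans (mul_le_mul_of_nonneg_right (sq_card_sub_div_four_le_liebSpin A)
    (Complex.nonneg_iff.mp (dotProduct_star_self_nonneg ψ)).1)
    (liebSpin_le_re_expect_stagSpinStructure hG A hA hΛ ht hU hψ hZ)

/-- **Both structure factors of THE `S^z = 0` half-filled ground state in one statement**
(ferrimagnetism): `Re⟨ψ, (Σ_{x,y} 𝐒_x·𝐒_y) ψ⟩ = S₀(S₀+1)‖ψ‖² ≤ Re⟨ψ, 𝓢_A ψ⟩`.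
[cite: ShenQiuTian1994, Theorem and eqs. (7)–(9)] [cite: LiebPRL1989, Theorem 2] -/
theorem re_expect_sum_sum_fermionSpinDot_le_re_expect_stagSpinStructure (hG : G.Connected) (A : Finset Λ)
    (hA : ∀ x y : Λ, G.Adj x y → (x ∈ A ↔ y ∉ A)) (hΛ : Even (Fintype.card Λ))
    {t U : ℝ} (ht : t ≠ 0) (hU : 0 < U) {ψ : Fock (Orb Λ)}
    (hψ : IsGroundState (hamiltonian G t U) (Fintype.card Λ) ψ) (hZ : HubbardWave0.spinZ *ᵥ ψ = 0) :
    (star ψ ⬝ᵥ ((∑ x, ∑ y, fermionSpinDot x y) *ᵥ ψ)).re ≤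
      (star ψ ⬝ᵥ (stagSpinStructure A *ᵥ ψ)).re := by
  rw [re_expect_sum_sum_fermionSpinDot_eq_of_isGroundState hG A hA hΛ ht hU hψ]
  exact liebSpin_le_re_expect_stagSpinStructure hG A hA hΛ ht hU hψ hZ

/-- **Existence form**: there is a half-filled ground state `ψ₀` (`S^z ψ₀ = 0`, unique up to a
scalar) whose uniform and staggered spin structure factors are both at least `¼(|A| - |B|)²‖ψ₀‖²`.
[cite: ShenQiuTian1994, Theorem and eqs. (7)–(9)] [cite: LiebPRL1989, Theorem 2] -/
theorem exists_groundState_ferrimagnetic_floors (hG : G.Connected) (A : Finset Λ)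
    (hA : ∀ x y : Λ, G.Adj x y → (x ∈ A ↔ y ∉ A)) (hΛ : Even (Fintype.card Λ))
    {t U : ℝ} (ht : t ≠ 0) (hU : 0 < U) :
    ∃ ψ₀ : Fock (Orb Λ), IsGroundState (hamiltonian G t U) (Fintype.card Λ) ψ₀ ∧
      HubbardWave0.spinZ *ᵥ ψ₀ = 0 ∧
      ((A.card : ℝ) - (Aᶜ.card : ℝ)) ^ 2 / 4 * (star ψ₀ ⬝ᵥ ψ₀).re ≤
        (star ψ₀ ⬝ᵥ ((∑ x, ∑ y, fermionSpinDot x y) *ᵥ ψ₀)).re ∧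
      ((A.card : ℝ) - (Aᶜ.card : ℝ)) ^ 2 / 4 * (star ψ₀ ⬝ᵥ ψ₀).re ≤
        (star ψ₀ ⬝ᵥ (stagSpinStructure A *ᵥ ψ₀)).re := by
  obtain ⟨ψ₀, hψ₀, hZ, -⟩ := exists_szZero_groundState hG A hA hΛ ht hU
  exact ⟨ψ₀, hψ₀, hZ, liebSpin_sq_le_re_expect_sum_sum_fermionSpinDot hG A hA hΛ ht hU hψ₀,
    sq_card_sub_le_re_expect_stagSpinStructure hG A hA hΛ ht hU hψ₀ hZ⟩

end ShenQiuTian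

end Literature.MathematicalPhysics.QuantumLattice
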